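import Summits.ResolutionOfSingularities.ResolutionOfSingularities.Theorems.WeightedInvariantContactCylinderValue
import Summits.ResolutionOfSingularities.ResolutionOfSingularities.Theorems.WeightedInvariantContactCylinderOpen
import HarnessLib

/-!
# The cylinder rule is PRESENTED along the stratum — (P3a-5) of ORDER (o28)
# (door `HypersurfaceCentreConstruction`, stmt-ResolutionOfSingularities-19897; KEY `stub_localWeightedDropEFT4S` beyond the
# P2 rung, regime P3a «the top stratum through the closed point is a regular germ of codimension two»)

Topic: `Summits/ResolutionOfSingularities/ResolutionOfSingularities/Theorems`. Helper for the door item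
`HypersurfaceCentreConstruction` (stmt-ResolutionOfSingularities-19897, route `WeightedInvariant`), line `local-engine` of
res-L1-w43-plan-1 (L W4.3), ORDER (o28) (lead res-type-005, co-hand res-D-brk-1).  Composition of (P3a-1) VALUE /
(P3a-3) PRESENTATION (`…ContactCylinderValue`, p522408) with res-type-005's (P3a-2) contraction brick
(`…ContactCylinderCompatibility`, p521270) into the `JOpenPresentationForallSing`-shape of the cylinder `J` for regime P3a:
the P2 data are read ONCE, at the generic point `A_𝔭` of the stratum, and the cylinder value is then presented by the SAME
pair `U = (x, g)` and weights `W = (1, b_max)` at EVERY point `𝔮 ⊇ 𝔭` of the stratum where `A_𝔮` is regular and `(x, g)`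
have independent differentials (res-type-005's (P3a-4) `exists_open_rsp_pair_along_prime` supplies exactly these points on a
basic open `D(h) ∋ 𝔭` of a model).

## Contents (sorry-free, standard axioms; NO definitions)

* `isLocalizationAtPrime_of_eq`, `isPrime_map_atPrime_of_le`, `comap_map_atPrime_of_le` — bookkeeping: `𝔭 A_𝔮` is a
  prime of `A_𝔮` lying over `𝔭`, and `(A_𝔮)_{𝔭 A_𝔮}` is a localisation of `A` at `𝔭` (Mathlib
  `IsLocalization.isLocalization_atPrime_localization_atPrime`).
* **`cylinder_open_presentation`** — `A` a ring, `𝔭` a prime with `A_𝔭` regular local, `x, g ∈ 𝔭` with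
  `(x/1, g/1) = 𝔪_{A_𝔭}` and `g/1 ∉ 𝔪_{A_𝔭}²`, `F ∈ A` with `F/1 ≠ 0` NOT of monomial type in `A_𝔭`, `g/1` carrying `F/1` to
  the terminal level `b_max ≥ 1` of `A_𝔭`.  Then at every prime `𝔮 ⊇ 𝔭` with `A_𝔮` regular local and `(x/1, g/1)` having
  independent differentials in `A_𝔮`:
  `(jContact ((A_𝔮)_{𝔭A_𝔮}) (F/1) m) ∩ A_𝔮 = (x, g; 1, b_max)_m · A_𝔮` for every `m`, with `b_max = bMax (F/1 ∈ A_𝔭)`.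
  Proof: the `A`-isomorphism `e : (A_𝔮)_{𝔭A_𝔮} ≃ A_𝔭` (`IsLocalization.algEquiv`) transports the P2 data to `T := (A_𝔮)_{𝔭A_𝔮}`
  (res-type-092's `isMonomialType_ringEquiv_iff`, `apply_mem_contactFiltration_iff`, `bMax_ringEquiv`, Literature
  `adicOrder_map_ringEquiv`, Mathlib `map_ringEquiv_maximalIdeal`, `IsRegularLocalRing.of_ringEquiv`); CASE B in coordinates
  in `T` (res-type-092 `weightedMonomialIdeal_eq_jContact`); `weightedMonomialIdeal_map` along `A → A_𝔮 → T`; contraction of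
  the `𝔭A_𝔮`-primary piece from `T` (res-type-005 `comap_map_weightedMonomialIdeal_eq_of_linearIndependent`).
* `cylinder_open_presentation_of_essFiniteType` — the same with `g/1 ∉ 𝔪²` derived from `dim A_𝔭 = 2` and the binder
  `1 ≤ b_max` DISCHARGED for `A` essentially of finite type over a field `k₀` (the door's models): `A_𝔭` is then essentially
  of finite type over `k₀` (Mathlib instance), hence excellent (res-type-092 `one_le_bMax_and_reaches_of_essFiniteType`).

[OURS · L1 W4.3 · (o28) P3a probe]  Replaces the role of NO printed item; NOT a statement of the manuscript
[claim: Hironaka2017, status: under-review]. AI work, weaker than expert review.  Pure commutative algebra; no named facts.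

## References

* H. Matsumura, *Commutative Ring Theory* (1987), Thm. 4.3 (localisation of a localisation), 14.2, 16.2, 19.3. [Matsumura1987]
* res-type-005, `plan/tools/res-type-005/o28/P3A-PROBE.md` (OURS, AI design input), §3 and FINDING 1.
-/

noncomputable section

open IsLocalRing Literature.AlgebraicGeometry.Resolution
open Summit.ResolutionOfSingularities.ResolutionOfSingularities.Cruxes.HypersurfaceCentreConstruction.LocalEngine

set_option linter.dupNamespace false -- mandated namespace of this single-conjunct summit

namespace Summit.ResolutionOfSingularities.ResolutionOfSingularities.Theorems

namespace ContactCylinder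

/-! ## Bookkeeping: `(A_𝔮)_{𝔭 A_𝔮}` is a localisation of `A` at `𝔭` -/

/-- Transport of `IsLocalization.AtPrime` along an equality of primes. [folklore] -/
theorem isLocalizationAtPrime_of_eq {A T : Type} [CommRing A] [CommRing T] [Algebra A T] {I J : Ideal A}
    [I.IsPrime] [J.IsPrime] (h : I = J) [hT : IsLocalization.AtPrime T I] : IsLocalization.AtPrime T J := by
  subst h
  exact hT

/-- For primes `𝔭 ≤ 𝔮`, the extension `𝔭 A_𝔮` is a prime of `A_𝔮`. [folklore] -/
theorem isPrime_map_atPrime_of_le {A : Type} [CommRing A] (𝔭 𝔮 : Ideal A) [𝔭.IsPrime] [𝔮.IsPrime] (h : 𝔭 ≤ 𝔮) :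
    (𝔭.map (algebraMap A (Localization.AtPrime 𝔮))).IsPrime :=
  IsLocalization.isPrime_of_isPrime_disjoint 𝔮.primeCompl (Localization.AtPrime 𝔮) 𝔭 ‹_›
    (Set.disjoint_left.mpr fun _ ha h𝔭a => ha (h h𝔭a))

/-- For primes `𝔭 ≤ 𝔮`, `𝔭 A_𝔮 ∩ A = 𝔭`. [folklore] -/
theorem comap_map_atPrime_of_le {A : Type} [CommRing A] (𝔭 𝔮 : Ideal A) [𝔭.IsPrime] [𝔮.IsPrime] (h : 𝔭 ≤ 𝔮) :
    (𝔭.map (algebraMap A (Localization.AtPrime 𝔮))).comap (algebraMap A (Localization.AtPrime 𝔮)) = 𝔭 :=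
  IsLocalization.under_map_of_isPrime_disjoint 𝔮.primeCompl (Localization.AtPrime 𝔮) ‹_›
    (Set.disjoint_left.mpr fun _ ha h𝔭a => ha (h h𝔭a))

/-- For primes `𝔭 ≤ 𝔮`, `(A_𝔮)_{𝔭 A_𝔮}` is a localisation of `A` at `𝔭` (Matsumura Thm. 4.3; Mathlib
`IsLocalization.isLocalization_atPrime_localization_atPrime`). [cite: Matsumura1987, Thm. 4.3] -/
theorem isLocalizationAtPrime_atPrime_map {A : Type} [CommRing A] (𝔭 𝔮 : Ideal A) [𝔭.IsPrime] [𝔮.IsPrime]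
    (h : 𝔭 ≤ 𝔮) [(𝔭.map (algebraMap A (Localization.AtPrime 𝔮))).IsPrime] :
    IsLocalization.AtPrime (Localization.AtPrime (𝔭.map (algebraMap A (Localization.AtPrime 𝔮)))) 𝔭 :=
  isLocalizationAtPrime_of_eq (comap_map_atPrime_of_le 𝔭 𝔮 h)

/-! ## (P3a-5) the cylinder value is presented by `(x, g; 1, b_max)` along the stratum -/

/-- **(P3a-5) The cylinder rule is presented along the stratum.**  `A` a ring, `𝔭` a prime with `A_𝔭` regular local;
`x, g ∈ 𝔭` with `(x/1, g/1) = 𝔪_{A_𝔭}` and `g/1 ∉ 𝔪_{A_𝔭}²` (a regular system of parameters of the P2 object at the generic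
point of the stratum, chosen in `𝔭`); `F ∈ A` with `F/1 ≠ 0` NOT of monomial type in `A_𝔭`, `g/1` a contact parameter of
`F/1` reaching the terminal level `b_max = bMax (F/1) ≥ 1` of `A_𝔭`.  Then at every prime `𝔮 ⊇ 𝔭` such that `A_𝔮` is
regular local and `(x/1, g/1)` have independent differentials in `A_𝔮` (the points of the stratum on res-type-005's
`D(h)`, (P3a-4)), for every `m`:
`(jContact ((A_𝔮)_{𝔭 A_𝔮}) (F/1) m) ∩ A_𝔮 = (weightedMonomialIdeal ![x, g] ![1, b_max] m) · A_𝔮` —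
the cylinder `J` of regime P3a is presented on a neighbourhood of the generic point of the stratum by ONE pair `U = (x, g)`
with weights `W = (1, b_max)` read once at `A_𝔭`. [OURS · L1 W4.3 · (o28) P3a-5] -/
theorem cylinder_open_presentation (A : Type) [CommRing A] (𝔭 : Ideal A) [𝔭.IsPrime]
    [IsRegularLocalRing (Localization.AtPrime 𝔭)] (x g F : A) (hx : x ∈ 𝔭) (hg : g ∈ 𝔭)
    (hxg : Ideal.span {algebraMap A (Localization.AtPrime 𝔭) x, algebraMap A (Localization.AtPrime 𝔭) g} =
      maximalIdeal (Localization.AtPrime 𝔭))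
    (hg2 : algebraMap A (Localization.AtPrime 𝔭) g ∉ maximalIdeal (Localization.AtPrime 𝔭) ^ 2)
    (hf0 : algebraMap A (Localization.AtPrime 𝔭) F ≠ 0)
    (hnm : ¬ IsMonomialType (algebraMap A (Localization.AtPrime 𝔭) F))
    (hreach : algebraMap A (Localization.AtPrime 𝔭) F ∈
      contactFiltration (algebraMap A (Localization.AtPrime 𝔭) g) (bMax (algebraMap A (Localization.AtPrime 𝔭) F))
        (bMax (algebraMap A (Localization.AtPrime 𝔭) F) * (adicOrder (algebraMap A (Localization.AtPrime 𝔭) F)).toNat))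
    (hb : 1 ≤ bMax (algebraMap A (Localization.AtPrime 𝔭) F))
    (𝔮 : Ideal A) [𝔮.IsPrime] (h𝔭𝔮 : 𝔭 ≤ 𝔮) [IsRegularLocalRing (Localization.AtPrime 𝔮)]
    (hXY : ∀ i, (![algebraMap A (Localization.AtPrime 𝔮) x, algebraMap A (Localization.AtPrime 𝔮) g] : Fin 2 → _) i ∈
      maximalIdeal (Localization.AtPrime 𝔮))
    (hli : LinearIndependent (ResidueField (Localization.AtPrime 𝔮)) (fun i =>
      (maximalIdeal (Localization.AtPrime 𝔮)).toCotangent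
        ⟨(![algebraMap A (Localization.AtPrime 𝔮) x, algebraMap A (Localization.AtPrime 𝔮) g] : Fin 2 → _) i, hXY i⟩))
    [(𝔭.map (algebraMap A (Localization.AtPrime 𝔮))).IsPrime] (m : ℕ) :
    (jContact (Localization.AtPrime (𝔭.map (algebraMap A (Localization.AtPrime 𝔮))))
        (algebraMap A _ F) m).comap
        (algebraMap (Localization.AtPrime 𝔮) (Localization.AtPrime (𝔭.map (algebraMap A (Localization.AtPrime 𝔮))))) =
      (weightedMonomialIdeal ![x, g] ![1, bMax (algebraMap A (Localization.AtPrime 𝔭) F)] m).map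
        (algebraMap A (Localization.AtPrime 𝔮)) := by
  -- `T := (A_𝔮)_{𝔭 A_𝔮}` is a localisation of `A` at `𝔭`; `e : T ≃ A_𝔭` over `A`
  haveI := isLocalizationAtPrime_atPrime_map 𝔭 𝔮 h𝔭𝔮
  set T := Localization.AtPrime (𝔭.map (algebraMap A (Localization.AtPrime 𝔮))) with hT
  let e : T ≃+* Localization.AtPrime 𝔭 :=
    (IsLocalization.algEquiv 𝔭.primeCompl T (Localization.AtPrime 𝔭)).toRingEquiv
  have he : ∀ a : A, e (algebraMap A T a) = algebraMap A (Localization.AtPrime 𝔭) a := fun a =>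
    (IsLocalization.algEquiv 𝔭.primeCompl T (Localization.AtPrime 𝔭)).commutes a
  have htower : ∀ a : A, algebraMap A T a =
      algebraMap (Localization.AtPrime 𝔮) T (algebraMap A (Localization.AtPrime 𝔮) a) := fun a =>
    IsScalarTower.algebraMap_apply A (Localization.AtPrime 𝔮) T a
  haveI : IsRegularLocalRing T := IsRegularLocalRing.of_ringEquiv e.symm
  -- the P2 data transported to `T`
  set yT := algebraMap A T F with hyT
  set xT := algebraMap A T x with hxT
  set gT := algebraMap A T g with hgT
  have hxgT : Ideal.span {xT, gT} = maximalIdeal T := by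
    rw [← map_ringEquiv_maximalIdeal e.symm, ← hxg, Ideal.map_span, Set.image_pair, ← he x, ← he g,
      RingEquiv.symm_apply_apply, RingEquiv.symm_apply_apply]
  have hg2T : gT ∉ maximalIdeal T ^ 2 := fun h =>
    hg2 (he g ▸ (apply_mem_maximalIdeal_pow_iff e gT 2).mpr h)
  have hf0T : yT ≠ 0 := fun h => hf0 (by rw [← he F, ← hyT, h, map_zero])
  have hnmT : ¬ IsMonomialType yT := fun h => hnm (he F ▸ (isMonomialType_ringEquiv_iff e yT).mpr h)
  have hBT : bMax yT = bMax (algebraMap A (Localization.AtPrime 𝔭) F) := by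
    rw [← bMax_ringEquiv e yT, he]
  have hbT : 1 ≤ bMax yT := hBT ▸ hb
  have hreachT : yT ∈ contactFiltration gT (bMax yT) (bMax yT * (adicOrder yT).toNat) := by
    rw [← apply_mem_contactFiltration_iff e yT gT, ← bMax_ringEquiv e yT, ← adicOrder_map_ringEquiv e yT, he, he]
    exact hreach
  -- CASE B in coordinates in `T`, pushed through `A → A_𝔮 → T`
  have hvecT : (fun i => algebraMap (Localization.AtPrime 𝔮) T
      ((![algebraMap A (Localization.AtPrime 𝔮) x, algebraMap A (Localization.AtPrime 𝔮) g] : Fin 2 → _) i)) =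
      ![xT, gT] := by
    funext i; fin_cases i
    · exact (htower x).symm
    · exact (htower g).symm
  have hvec𝔮 : (fun i => algebraMap A (Localization.AtPrime 𝔮) ((![x, g] : Fin 2 → A) i)) =
      ![algebraMap A (Localization.AtPrime 𝔮) x, algebraMap A (Localization.AtPrime 𝔮) g] := by
    funext i; fin_cases i <;> rfl
  have hJT : jContact T yT m =
      (weightedMonomialIdeal ![algebraMap A (Localization.AtPrime 𝔮) x, algebraMap A (Localization.AtPrime 𝔮) g]
        ![1, bMax (algebraMap A (Localization.AtPrime 𝔭) F)] m).map (algebraMap (Localization.AtPrime 𝔮) T) := by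
    rw [← hBT, ← weightedMonomialIdeal_eq_jContact T hf0T hnmT hxgT hg2T hbT hreachT m, weightedMonomialIdeal_map, hvecT]
  have hu𝔭 : ∀ i, (![algebraMap A (Localization.AtPrime 𝔮) x, algebraMap A (Localization.AtPrime 𝔮) g] : Fin 2 → _) i ∈
      𝔭.map (algebraMap A (Localization.AtPrime 𝔮)) := by
    intro i; fin_cases i
    · exact Ideal.mem_map_of_mem _ hx
    · exact Ideal.mem_map_of_mem _ hg
  rw [hJT, weightedMonomialIdeal_map (algebraMap A (Localization.AtPrime 𝔮)), hvec𝔮]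
  rcases Nat.eq_zero_or_pos m with rfl | hm
  · rw [weightedMonomialIdeal_zero, Ideal.map_top, Ideal.comap_top]
  · exact comap_map_weightedMonomialIdeal_eq_of_linearIndependent (𝔭.map (algebraMap A (Localization.AtPrime 𝔮)))
      ![algebraMap A (Localization.AtPrime 𝔮) x, algebraMap A (Localization.AtPrime 𝔮) g] hXY hli hu𝔭
      ![1, bMax (algebraMap A (Localization.AtPrime 𝔭) F)] (Fin.forall_fin_two.2 ⟨Nat.one_pos, hb⟩) hm

/-- **(P3a-5) at the door's models** (`A` essentially of finite type over a field `k₀`, `dim A_𝔭 = 2`): the side conditions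
`g/1 ∉ 𝔪_{A_𝔭}²` and `1 ≤ b_max` of `cylinder_open_presentation` are discharged — two generators of the maximal ideal of a
regular local ring of dimension two lie outside `𝔪²` (`LocalGameEFTSteepening.not_mem_sq_of_span_pair_eq`), and `A_𝔭` is
essentially of finite type over `k₀`, hence excellent, so `b_max (F/1) ≥ 1` (res-type-092
`one_le_bMax_and_reaches_of_essFiniteType`, with `F/1 ∈ 𝔪²` by `mem_sq_of_not_isMonomialType`). [OURS · L1 W4.3 · (o28) P3a-5] -/
theorem cylinder_open_presentation_of_essFiniteType (k₀ : Type) [Field k₀] (A : Type) [CommRing A] [Algebra k₀ A]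
    [Algebra.EssFiniteType k₀ A] (𝔭 : Ideal A) [𝔭.IsPrime] [IsRegularLocalRing (Localization.AtPrime 𝔭)]
    (hdim : ringKrullDim (Localization.AtPrime 𝔭) = 2) (x g F : A) (hx : x ∈ 𝔭) (hg : g ∈ 𝔭)
    (hxg : Ideal.span {algebraMap A (Localization.AtPrime 𝔭) x, algebraMap A (Localization.AtPrime 𝔭) g} =
      maximalIdeal (Localization.AtPrime 𝔭))
    (hf0 : algebraMap A (Localization.AtPrime 𝔭) F ≠ 0)
    (hnm : ¬ IsMonomialType (algebraMap A (Localization.AtPrime 𝔭) F))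
    (hreach : algebraMap A (Localization.AtPrime 𝔭) F ∈
      contactFiltration (algebraMap A (Localization.AtPrime 𝔭) g) (bMax (algebraMap A (Localization.AtPrime 𝔭) F))
        (bMax (algebraMap A (Localization.AtPrime 𝔭) F) * (adicOrder (algebraMap A (Localization.AtPrime 𝔭) F)).toNat))
    (𝔮 : Ideal A) [𝔮.IsPrime] (h𝔭𝔮 : 𝔭 ≤ 𝔮) [IsRegularLocalRing (Localization.AtPrime 𝔮)]
    (hXY : ∀ i, (![algebraMap A (Localization.AtPrime 𝔮) x, algebraMap A (Localization.AtPrime 𝔮) g] : Fin 2 → _) i ∈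
      maximalIdeal (Localization.AtPrime 𝔮))
    (hli : LinearIndependent (ResidueField (Localization.AtPrime 𝔮)) (fun i =>
      (maximalIdeal (Localization.AtPrime 𝔮)).toCotangent
        ⟨(![algebraMap A (Localization.AtPrime 𝔮) x, algebraMap A (Localization.AtPrime 𝔮) g] : Fin 2 → _) i, hXY i⟩))
    [(𝔭.map (algebraMap A (Localization.AtPrime 𝔮))).IsPrime] (m : ℕ) :
    1 ≤ bMax (algebraMap A (Localization.AtPrime 𝔭) F) ∧
    (jContact (Localization.AtPrime (𝔭.map (algebraMap A (Localization.AtPrime 𝔮))))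
        (algebraMap A _ F) m).comap
        (algebraMap (Localization.AtPrime 𝔮) (Localization.AtPrime (𝔭.map (algebraMap A (Localization.AtPrime 𝔮))))) =
      (weightedMonomialIdeal ![x, g] ![1, bMax (algebraMap A (Localization.AtPrime 𝔭) F)] m).map
        (algebraMap A (Localization.AtPrime 𝔮)) := by
  have hg2 := (LocalGameEFTSteepening.not_mem_sq_of_span_pair_eq (by exact_mod_cast hdim) hxg).2
  have hgm : algebraMap A (Localization.AtPrime 𝔭) g ∈ maximalIdeal (Localization.AtPrime 𝔭) :=
    hxg ▸ Ideal.subset_span (by simp)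
  have hf2 := mem_sq_of_not_isMonomialType hf0 hnm ⟨_, hgm, hg2⟩
  have hb := (one_le_bMax_and_reaches_of_essFiniteType k₀ (Localization.AtPrime 𝔭) hf0 hf2 hnm).1
  exact ⟨hb, cylinder_open_presentation A 𝔭 x g F hx hg hxg hg2 hf0 hnm hreach hb 𝔮 h𝔭𝔮 hXY hli m⟩

/-- **(P3a-5) ∘ (P3a-4): the cylinder `J` of regime P3a is presented on a basic open along the stratum of a MODEL.**
`A` of finite type over a perfect field `k`, `𝔭` a prime with `A_𝔭` regular local of dimension two, `(x, g) A_𝔭 = 𝔪_{A_𝔭}`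
(a regular system of parameters of the P2 object chosen in `A`), `F ∈ A` with `F/1 ≠ 0` NOT of monomial type in `A_𝔭` and
`g/1` carrying `F/1` to the terminal level of `A_𝔭`.  Then `b_max (F/1) ≥ 1`, and there is `h ∉ 𝔭` such that at EVERY prime
`𝔮 ∈ V(x, g) ∩ D(h)`: `𝔭 ≤ 𝔮` and `(jContact ((A_𝔮)_{𝔭A_𝔮}) (F/1) m) ∩ A_𝔮 = (x, g; 1, b_max)_m · A_𝔮` for every `m`
(res-type-005's (P3a-4) `exists_open_rsp_pair_along_prime` p522933 feeds `cylinder_open_presentation_of_essFiniteType`) —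
the literal (open″)/(pres) J-conjunct of the KEY's clause shape for regime P3a, with `U = (x, g)`, `W = (1, b_max)`.
[OURS · L1 W4.3 · (o28) P3a-5] -/
theorem exists_basicOpen_cylinder_presentation (k : Type) [Field k] [PerfectField k] (A : Type) [CommRing A]
    [Algebra k A] [Algebra.FiniteType k A] (𝔭 : Ideal A) [𝔭.IsPrime] [IsRegularLocalRing (Localization.AtPrime 𝔭)]
    (hdim : ringKrullDim (Localization.AtPrime 𝔭) = 2) (x g F : A)
    (hxg : (Ideal.span {x, g}).map (algebraMap A (Localization.AtPrime 𝔭)) = maximalIdeal (Localization.AtPrime 𝔭))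
    (hf0 : algebraMap A (Localization.AtPrime 𝔭) F ≠ 0)
    (hnm : ¬ IsMonomialType (algebraMap A (Localization.AtPrime 𝔭) F))
    (hreach : algebraMap A (Localization.AtPrime 𝔭) F ∈
      contactFiltration (algebraMap A (Localization.AtPrime 𝔭) g) (bMax (algebraMap A (Localization.AtPrime 𝔭) F))
        (bMax (algebraMap A (Localization.AtPrime 𝔭) F) * (adicOrder (algebraMap A (Localization.AtPrime 𝔭) F)).toNat)) :
    1 ≤ bMax (algebraMap A (Localization.AtPrime 𝔭) F) ∧
    ∃ h ∉ 𝔭, ∀ (𝔮 : Ideal A) [𝔮.IsPrime], h ∉ 𝔮 → x ∈ 𝔮 → g ∈ 𝔮 →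
      𝔭 ≤ 𝔮 ∧ ∀ [(𝔭.map (algebraMap A (Localization.AtPrime 𝔮))).IsPrime] (m : ℕ),
        (jContact (Localization.AtPrime (𝔭.map (algebraMap A (Localization.AtPrime 𝔮))))
            (algebraMap A _ F) m).comap
            (algebraMap (Localization.AtPrime 𝔮)
              (Localization.AtPrime (𝔭.map (algebraMap A (Localization.AtPrime 𝔮))))) =
          (weightedMonomialIdeal ![x, g] ![1, bMax (algebraMap A (Localization.AtPrime 𝔭) F)] m).map
            (algebraMap A (Localization.AtPrime 𝔮)) := by
  have hxg' : Ideal.span {algebraMap A (Localization.AtPrime 𝔭) x, algebraMap A (Localization.AtPrime 𝔭) g} =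
      maximalIdeal (Localization.AtPrime 𝔭) := by
    rw [← hxg, Ideal.map_span, Set.image_pair]
  have hmem : ∀ a : A, algebraMap A (Localization.AtPrime 𝔭) a ∈ maximalIdeal (Localization.AtPrime 𝔭) → a ∈ 𝔭 :=
    fun a ha => (IsLocalization.AtPrime.to_map_mem_maximal_iff (Localization.AtPrime 𝔭) 𝔭 a).mp ha
  have hx : x ∈ 𝔭 := hmem x (hxg' ▸ Ideal.subset_span (by simp))
  have hg : g ∈ 𝔭 := hmem g (hxg' ▸ Ideal.subset_span (by simp))
  have hg2 := (LocalGameEFTSteepening.not_mem_sq_of_span_pair_eq (by exact_mod_cast hdim) hxg').2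
  have hf2 := mem_sq_of_not_isMonomialType hf0 hnm ⟨_, hxg' ▸ Ideal.subset_span (by simp), hg2⟩
  have hb := (one_le_bMax_and_reaches_of_essFiniteType k (Localization.AtPrime 𝔭) hf0 hf2 hnm).1
  obtain ⟨h, hh𝔭, H⟩ := exists_open_rsp_pair_along_prime k A 𝔭 hdim x g hxg
  refine ⟨hb, h, hh𝔭, fun 𝔮 _ hh𝔮 hx𝔮 hg𝔮 => ?_⟩
  obtain ⟨h𝔭𝔮, hreg, -, h𝔮mem, hli⟩ := H 𝔮 hh𝔮 hx𝔮 hg𝔮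
  refine ⟨h𝔭𝔮, fun m => ?_⟩
  haveI := hreg
  have hXY : ∀ i, (![algebraMap A (Localization.AtPrime 𝔮) x, algebraMap A (Localization.AtPrime 𝔮) g] : Fin 2 → _) i ∈
      maximalIdeal (Localization.AtPrime 𝔮) := by
    intro i; fin_cases i
    · exact h𝔮mem 0
    · exact h𝔮mem 1
  have hfun : (fun i => (maximalIdeal (Localization.AtPrime 𝔮)).toCotangent
        ⟨algebraMap A _ ((![x, g] : Fin 2 → A) i), h𝔮mem i⟩) =
      (fun i => (maximalIdeal (Localization.AtPrime 𝔮)).toCotangent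
        ⟨(![algebraMap A (Localization.AtPrime 𝔮) x, algebraMap A (Localization.AtPrime 𝔮) g] : Fin 2 → _) i,
          hXY i⟩) := by
    funext i; fin_cases i <;> rfl
  rw [hfun] at hli
  exact cylinder_open_presentation A 𝔭 x g F hx hg hxg' hg2 hf0 hnm hreach hb 𝔮 h𝔭𝔮 hXY hli m

end ContactCylinder

end Summit.ResolutionOfSingularities.ResolutionOfSingularities.Theorems

end
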